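import Summits.BirchSwinnertonDyer.BirchSwinnertonDyer.Theorems.GenusKolyvaginAtTwoTorsionCellD0NegPrimeTwistClasses
import HarnessLib

/-!
# D0≤2, one genus step: the symbols of an admissible pair `(q₁, q₂)` and the parity character at a twisting prime

Crux R″ `RankOneTwoTorsionResidualAtTwo` (stmt-27478), LINE 49 «full_vertex», stub D0≤2
`FullTorsionGenusSelmerLawUpToTwoAtTwo`, slice `#Q₀ = 2` (`C₀ = E₀^{(M₀)}`, `M₀ = q₁* q₂* = q₁q₂` for two full-admissible
primes `q₁, q₂ ≡ 3 (mod 4)` with every `ℓ ∣ 2N₀` split in `ℚ(√M₀)`). This file supplies the arithmetic inputs of the count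
`#Sel⁽²⁾(E₀^{(M₀)}) = 4` (sequel `…D0PairTwistCount.lean`; LEAD memo `D0le2_memo.md` §1–2(a), evidence #48 on 27478):

* **(R1)** `qrBit_eq_qrBit_of_legendreSym_mul_eq_one` — for an odd prime `ℓ ∉ {q₁, q₂}` with `(q₁q₂/ℓ) = 1`:
  `qr_{q₁}(ℓ) = qr_{q₂}(ℓ)` (quadratic reciprocity, both `qᵢ ≡ 3 (mod 4)`); `qrBit_two_eq_qrBit_two_of_mul_emod_eight`
  — `qr_{q₁}(2) = qr_{q₂}(2)` when `q₁q₂ ≡ 1 (mod 8)`; `qrBit_neg_one_eq_one_of_emod_four` — `qr_q(−1) = 1`;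
* `qrBit_swap_eq_add_one` — `qr_{q₂}(q₁) = qr_{q₁}(q₂) + 1` (reciprocity for two primes `≡ 3 (mod 4)`);
* `isSquare_mul_adicCompletion_of_legendreSym` / `_two` — `q₁q₂` is a square in `ℚ_ℓ` for `ℓ ∈ S`;
* **`natCard_selmerGroup_quadraticTwist_eq_four_mul`** — for ANY twist `E^{(d)}` and a prime `q` with `v_q(d) = 1` at
  which the root differences are units, the parity-pair character of `Sel⁽²⁾(E^{(d)})` at `q` is ONTO `(ℤ/2)²`
  (the torsion classes `κ(T₁)`, `κ(T₂)` have parities `(0,1)`, `(1,0)`): `#Sel⁽²⁾(E^{(d)}) = 4 · #N_q`.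

Everything is proved; no LINE 49 statement is restated; BSD is not advanced by this file alone.

## References

* [SilvermanAEC2009] J. H. Silverman, *The Arithmetic of Elliptic Curves*, 2nd ed., GTM 106, Springer 2009,
  Prop. X.1.4, Thm. X.4.2, Prop. X.4.9.
* [Kramer1981] K. Kramer, *Arithmetic of elliptic curves upon quadratic extension*, Trans. AMS 264 (1981), Thm. 1.
* [ShuZhai2021] J. Shu, S. Zhai, arXiv:2102.11808, Def. 1.1, Thm. 1.4 (ii).
-/

noncomputable section

open scoped Classical

namespace Summit.BirchSwinnertonDyer.BirchSwinnertonDyer.Theorems.GenusKolyvaginAtTwo.TorsionCellD0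

open WeierstrassCurve WeierstrassCurve.Affine WeierstrassCurve.Affine.Point
open Literature.NumberTheory.GaloisRepresentations Literature.NumberTheory.EllipticCurves Field
open Literature.NumberTheory.EllipticCurves.TwoDescentLocal
open Literature.NumberTheory.EllipticCurves.KramerTwoDescent
open IsDedekindDomain NumberField Rat.HeightOneSpectrum

/-! ## (R1): the symbols of an admissible pair -/

section Symbols

variable {q q₁ q₂ : ℕ} [hq : Fact q.Prime] [hq₁ : Fact q₁.Prime] [hq₂ : Fact q₂.Prime]

/-- `qr_q(−1) = 1` for `q ≡ 3 (mod 4)`. [folklore] -/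
theorem qrBit_neg_one_eq_one_of_emod_four (hq4 : q % 4 = 3) : qrBit q (-1 : ℚ) = 1 := by
  have hq2 : q ≠ 2 := by rintro rfl; norm_num at hq4
  have hj : jacobiSym (-1) q = -1 := by
    rw [← jacobiSym.legendreSym.to_jacobiSym, legendreSym.at_neg_one hq2, ZMod.χ₄_nat_eq_if_mod_four,
      if_neg (by omega), if_neg (by omega)]
  have h := qrBit_intCast_of_jacobiSym_eq_neg_one (p := q) hj
  exact_mod_cast h

/-- `qr_q` of a natural number prime to `q`, through the Legendre symbol: value `0` at a residue. [folklore] -/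
private theorem qrBit_natCast_eq_zero {n : ℕ} (h1 : legendreSym q n = 1) : qrBit q (n : ℚ) = 0 := by
  have h := qrBit_intCast_of_jacobiSym_eq_one (p := q) (m := n) (by rw [← jacobiSym.legendreSym.to_jacobiSym]; exact h1)
  exact_mod_cast h

/-- `qr_q` of a natural number prime to `q`, through the Legendre symbol: value `1` at a non-residue. [folklore] -/
private theorem qrBit_natCast_eq_one {n : ℕ} (h1 : legendreSym q n = -1) : qrBit q (n : ℚ) = 1 := by
  have h := qrBit_intCast_of_jacobiSym_eq_neg_one (p := q) (m := n) (by rw [← jacobiSym.legendreSym.to_jacobiSym]; exact h1)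
  exact_mod_cast h

/-- `qr_q(n)` only depends on the Legendre symbol `(n/q)` (for `q ∤ n`, `q' ∤ n`). [folklore] -/
private theorem qrBit_natCast_eq_of_legendreSym_eq {q' : ℕ} [Fact q'.Prime] {n : ℕ} (hn : ¬ q ∣ n)
    (heq : legendreSym q n = legendreSym q' n) : qrBit q (n : ℚ) = qrBit q' (n : ℚ) := by
  have h0 : ((n : ℤ) : ZMod q) ≠ 0 := by
    rw [Ne, ZMod.intCast_zmod_eq_zero_iff_dvd]; exact_mod_cast hn
  rcases legendreSym.eq_one_or_neg_one q h0 with h1 | h1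
  · rw [qrBit_natCast_eq_zero h1, qrBit_natCast_eq_zero (heq ▸ h1)]
  · rw [qrBit_natCast_eq_one h1, qrBit_natCast_eq_one (heq ▸ h1)]

/-- **(R1) at an odd prime**: for primes `q₁, q₂ ≡ 3 (mod 4)` and an odd prime `ℓ ∉ {q₁, q₂}` with `(q₁q₂/ℓ) = 1`,
`qr_{q₁}(ℓ) = qr_{q₂}(ℓ)` — both are `(ℓ/qᵢ) = (qᵢ/ℓ)·(−1)^{(ℓ−1)/2}` and `(q₁/ℓ) = (q₂/ℓ)`. [folklore] -/
theorem qrBit_eq_qrBit_of_legendreSym_mul_eq_one (hq₁4 : q₁ % 4 = 3) (hq₂4 : q₂ % 4 = 3) {ℓ : ℕ} (hℓ : ℓ.Prime)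
    (hℓ2 : ℓ ≠ 2) (hℓ₁ : ℓ ≠ q₁) (hℓ₂ : ℓ ≠ q₂)
    (hM : haveI : Fact ℓ.Prime := ⟨hℓ⟩; legendreSym ℓ ((q₁ : ℤ) * q₂) = 1) :
    qrBit q₁ (ℓ : ℚ) = qrBit q₂ (ℓ : ℚ) := by
  haveI : Fact ℓ.Prime := ⟨hℓ⟩
  have hq₁2 : q₁ ≠ 2 := by rintro rfl; norm_num at hq₁4
  have hq₂2 : q₂ ≠ 2 := by rintro rfl; norm_num at hq₂4
  -- `(q₁/ℓ) = (q₂/ℓ)`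
  have h01 : ((q₁ : ℤ) : ZMod ℓ) ≠ 0 := by
    rw [Ne, ZMod.intCast_zmod_eq_zero_iff_dvd]; intro hd
    exact hℓ₁ ((Nat.prime_dvd_prime_iff_eq hℓ hq₁.out).mp (by exact_mod_cast hd))
  have h02 : ((q₂ : ℤ) : ZMod ℓ) ≠ 0 := by
    rw [Ne, ZMod.intCast_zmod_eq_zero_iff_dvd]; intro hd
    exact hℓ₂ ((Nat.prime_dvd_prime_iff_eq hℓ hq₂.out).mp (by exact_mod_cast hd))
  rw [legendreSym.mul] at hM
  have heq : legendreSym ℓ q₁ = legendreSym ℓ q₂ := by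
    rcases legendreSym.eq_one_or_neg_one ℓ h01 with h1 | h1 <;>
      rcases legendreSym.eq_one_or_neg_one ℓ h02 with h2 | h2 <;> rw [h1, h2] at hM ⊢ <;> norm_num at hM
  -- reciprocity, the same sign for `q₁` and `q₂`
  have hrec : legendreSym q₁ ℓ = legendreSym q₂ ℓ := by
    rcases Nat.odd_mod_four_iff.mp (Nat.odd_iff.mp (hℓ.odd_of_ne_two hℓ2)) with h1 | h3
    · rw [legendreSym.quadratic_reciprocity_one_mod_four h1 hq₁2, legendreSym.quadratic_reciprocity_one_mod_four h1 hq₂2,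
        heq]
    · rw [legendreSym.quadratic_reciprocity_three_mod_four h3 hq₁4, legendreSym.quadratic_reciprocity_three_mod_four h3 hq₂4,
        heq]
  exact qrBit_natCast_eq_of_legendreSym_eq (fun hd => hℓ₁ ((Nat.prime_dvd_prime_iff_eq hq₁.out hℓ).mp hd).symm) hrec

/-- **(R1) at `2`**: `qr_{q₁}(2) = qr_{q₂}(2)` for primes `q₁, q₂ ≡ 3 (mod 4)` with `q₁q₂ ≡ 1 (mod 8)` (then
`q₁ ≡ q₂ (mod 8)`). [folklore] -/
theorem qrBit_two_eq_qrBit_two_of_mul_emod_eight (hq₁4 : q₁ % 4 = 3) (hq₂4 : q₂ % 4 = 3)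
    (hM8 : ((q₁ : ℤ) * q₂) % 8 = 1) : qrBit q₁ (2 : ℚ) = qrBit q₂ (2 : ℚ) := by
  have hq₁2 : q₁ ≠ 2 := by rintro rfl; norm_num at hq₁4
  have hq₂2 : q₂ ≠ 2 := by rintro rfl; norm_num at hq₂4
  have hmod : q₁ % 8 = q₂ % 8 := by
    have h1 : q₁ % 8 = 3 ∨ q₁ % 8 = 7 := by omega
    have h2 : q₂ % 8 = 3 ∨ q₂ % 8 = 7 := by omega
    have hM8' : (q₁ * q₂) % 8 = 1 := by exact_mod_cast hM8
    rcases h1 with h1 | h1 <;> rcases h2 with h2 | h2 <;> simp [Nat.mul_mod, h1, h2] at hM8' ⊢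
  have key : legendreSym q₁ 2 = legendreSym q₂ 2 := by
    rw [legendreSym.at_two hq₁2, legendreSym.at_two hq₂2, ZMod.χ₈_nat_eq_if_mod_eight, ZMod.χ₈_nat_eq_if_mod_eight,
      show q₁ % 2 = q₂ % 2 by omega, hmod]
  have h := qrBit_natCast_eq_of_legendreSym_eq (q := q₁) (q' := q₂) (n := 2)
    (fun hd => hq₁2 ((Nat.prime_dvd_prime_iff_eq hq₁.out Nat.prime_two).mp hd)) (by exact_mod_cast key)
  exact_mod_cast h

/-- **Reciprocity for the pair**: `qr_{q₂}(q₁) = qr_{q₁}(q₂) + 1` for distinct primes `q₁, q₂ ≡ 3 (mod 4)`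
(`(q₁/q₂) = −(q₂/q₁)`). [folklore] -/
theorem qrBit_swap_eq_add_one (hq₁4 : q₁ % 4 = 3) (hq₂4 : q₂ % 4 = 3) (hne : q₁ ≠ q₂) :
    qrBit q₂ (q₁ : ℚ) = qrBit q₁ (q₂ : ℚ) + 1 := by
  have hrec := legendreSym.quadratic_reciprocity_three_mod_four hq₁4 hq₂4  -- `(q₂/q₁)·… : legendreSym q₂ q₁ = -legendreSym q₁ q₂`
  have h0 : ((q₂ : ℤ) : ZMod q₁) ≠ 0 := by
    rw [Ne, ZMod.intCast_zmod_eq_zero_iff_dvd]; intro hd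
    exact hne ((Nat.prime_dvd_prime_iff_eq hq₁.out hq₂.out).mp (by exact_mod_cast hd))
  rcases legendreSym.eq_one_or_neg_one q₁ h0 with h1 | h1
  · rw [qrBit_natCast_eq_zero (q := q₁) h1, qrBit_natCast_eq_one (q := q₂) (by rw [hrec, h1])]; decide
  · rw [qrBit_natCast_eq_one (q := q₁) h1, qrBit_natCast_eq_zero (q := q₂) (by rw [hrec, h1]; norm_num)]; decide

/-- `q₁q₂` is a square in `ℚ_v` for a finite place `v` over an odd prime `ℓ ∉ {q₁, q₂}` with `(q₁q₂/ℓ) = 1`. [folklore] -/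
theorem isSquare_mul_adicCompletion_of_legendreSym (v : HeightOneSpectrum (𝓞 ℚ)) {ℓ : ℕ} [hℓ : Fact ℓ.Prime]
    (hv : (primesEquiv v : ℕ) = ℓ) (hℓ2 : ℓ ≠ 2) (hℓ₁ : ℓ ≠ q₁) (hℓ₂ : ℓ ≠ q₂)
    (hM : legendreSym ℓ ((q₁ : ℤ) * q₂) = 1) :
    IsSquare (algebraMap ℚ (v.adicCompletion ℚ) ((q₁ : ℚ) * q₂)) := by
  have h0 : (q₁ : ℚ) * q₂ ≠ 0 := mul_ne_zero (by exact_mod_cast hq₁.out.ne_zero) (by exact_mod_cast hq₂.out.ne_zero)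
  have hv₁ : padicValRat ℓ (q₁ : ℚ) = 0 := by
    rw [show (q₁ : ℚ) = ((q₁ : ℕ) : ℚ) from rfl, padicValRat.of_nat]; exact_mod_cast padicValNat_primes hℓ₁
  have hv₂ : padicValRat ℓ (q₂ : ℚ) = 0 := by
    rw [show (q₂ : ℚ) = ((q₂ : ℕ) : ℚ) from rfl, padicValRat.of_nat]; exact_mod_cast padicValNat_primes hℓ₂
  refine isSquare_algebraMap_adicCompletion_of_bits v hv hℓ2 h0 ?_ ?_
  · rw [parityBit, padicValRat.mul (by exact_mod_cast hq₁.out.ne_zero) (by exact_mod_cast hq₂.out.ne_zero), hv₁, hv₂]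
    rfl
  · have hj : jacobiSym ((q₁ : ℤ) * q₂) ℓ = 1 := by rw [← jacobiSym.legendreSym.to_jacobiSym]; exact hM
    have h := qrBit_intCast_of_jacobiSym_eq_one (p := ℓ) hj
    exact_mod_cast h

/-- `q₁q₂` is a square in `ℚ_v` for the place `v` over `2` when `q₁q₂ ≡ 1 (mod 8)`. [folklore] -/
theorem isSquare_mul_adicCompletion_two (hq₁4 : q₁ % 4 = 3) (hq₂4 : q₂ % 4 = 3) (hM8 : ((q₁ : ℤ) * q₂) % 8 = 1)
    (v : HeightOneSpectrum (𝓞 ℚ)) (hv : (primesEquiv v : ℕ) = 2) :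
    IsSquare (algebraMap ℚ (v.adicCompletion ℚ) ((q₁ : ℚ) * q₂)) := by
  have hq₁2 : q₁ ≠ 2 := by rintro rfl; norm_num at hq₁4
  have hq₂2 : q₂ ≠ 2 := by rintro rfl; norm_num at hq₂4
  haveI : Fact (Nat.Prime 2) := ⟨Nat.prime_two⟩
  have h0 : (q₁ : ℚ) * q₂ ≠ 0 := mul_ne_zero (by exact_mod_cast hq₁.out.ne_zero) (by exact_mod_cast hq₂.out.ne_zero)
  have hodd : ¬ (2 : ℤ) ∣ (q₁ : ℤ) * q₂ := by
    intro h; have : ((q₁ : ℤ) * q₂) % 2 = 0 := Int.emod_emod_of_dvd _ (by norm_num : (2:ℤ) ∣ 8) ▸ by omega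
    omega
  refine isSquare_algebraMap_adicCompletion_two_of_res8 v hv h0 ?_ ?_
  · rw [show (q₁ : ℚ) * q₂ = (((q₁ : ℤ) * q₂ : ℤ) : ℚ) by push_cast; rfl, padicValRat.of_int,
      padicValInt.eq_zero_of_not_dvd hodd]
    exact ⟨0, rfl⟩
  · rw [show (q₁ : ℚ) * q₂ = (((q₁ : ℤ) * q₂ : ℤ) : ℚ) by push_cast; rfl, res8_intCast hodd]
    have h8 : (8 : ℤ) ∣ (q₁ : ℤ) * q₂ - 1 := by omega
    have := (ZMod.intCast_eq_intCast_iff_dvd_sub 1 ((q₁ : ℤ) * q₂) (2 ^ 3)).mpr (by norm_num; exact h8)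
    rw [← this]; simp

end Symbols

/-! ## The parity-pair character at a twisting prime is onto -/

section Parity

variable (E : WeierstrassCurve ℚ) [E.IsElliptic] {e₁ e₂ e₃ : ℚ}

/-- **`#Sel⁽²⁾(E^{(d)}/ℚ) = 4 · #N_q` at a twisting prime `q`** (`v_q(d) = 1`, root differences `q`-units): the torsion
classes `κ(T₁) = (d²(e₁-e₂)(e₁-e₃), d(e₁-e₂))`, `κ(T₂) = (d(e₂-e₁), d²(e₂-e₁)(e₂-e₃))` of the twist have `q`-parities
`(0,1)`, `(1,0)`, so the parity-pair character is onto `(ℤ/2)²`. [cite: SilvermanAEC2009, Prop. X.1.4, Thm. X.4.2] -/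
theorem natCard_selmerGroup_quadraticTwist_eq_four_mul (h : E.toAffine.SplitTwoTorsion e₁ e₂ e₃) {d : ℚ}
    {q : ℕ} [hq : Fact q.Prime] (hvd : padicValRat q d = 1)
    (hgq : padicValRat q (e₁ - e₂) = 0 ∧ padicValRat q (e₁ - e₃) = 0 ∧ padicValRat q (e₂ - e₃) = 0)
    [(E.quadraticTwist d).IsElliptic] :
    Nat.card (selmerGroup (E.quadraticTwist d) 2) =
      4 * Nat.card {c : galH1Torsion (E.quadraticTwist d) 2 // c ∈ selmerGroup (E.quadraticTwist d) 2 ∧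
        parityHom q (kummerEquiv ℚ 2 ((E.quadraticTwist d).twoTorsionCharH1 (h.quadraticTwist d) c)) = 0 ∧
        parityHom q (kummerEquiv ℚ 2 ((E.quadraticTwist d).twoTorsionCharH1 (h.quadraticTwist d).swap₁₂ c)) = 0} := by
  have h' := h.quadraticTwist d
  obtain ⟨h12, h13, h23⟩ := hgq
  have hd0 : d ≠ 0 := by intro hd0; rw [hd0, padicValRat.zero] at hvd; exact zero_ne_one hvd
  have he12 : e₁ - e₂ ≠ 0 := sub_ne_zero.mpr h.ne₁₂
  have he21 : e₂ - e₁ ≠ 0 := sub_ne_zero.mpr h.ne₁₂.symm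
  have he13 : e₁ - e₃ ≠ 0 := sub_ne_zero.mpr h.ne₁₃
  have he23 : e₂ - e₃ ≠ 0 := sub_ne_zero.mpr h.ne₂₃
  have h21 : padicValRat q (e₂ - e₁) = 0 := by rw [← neg_sub, padicValRat.neg, h12]
  have hp2 : ∀ {t : ℚ} (ht : t ≠ 0), padicValRat q t = 0 → parityBit q (d ^ 2 * t) = 0 := by
    intro t ht h0
    rw [parityBit, padicValRat.mul (pow_ne_zero 2 hd0) ht, padicValRat.pow d, hvd, h0]; decide
  have hp1 : ∀ {t : ℚ} (ht : t ≠ 0), padicValRat q t = 0 → parityBit q (d * t) = 1 := by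
    intro t ht h0
    rw [parityBit, padicValRat.mul hd0 ht, hvd, h0]; decide
  have hT1a : (d * e₁ - d * e₂) * (d * e₁ - d * e₃) = d ^ 2 * ((e₁ - e₂) * (e₁ - e₃)) := by ring
  have hT1b : d * e₁ - d * e₂ = d * (e₁ - e₂) := by ring
  have hT2a : d * e₂ - d * e₁ = d * (e₂ - e₁) := by ring
  have hT2b : (d * e₂ - d * e₁) * (d * e₂ - d * e₃) = d ^ 2 * ((e₂ - e₁) * (e₂ - e₃)) := by ring
  have hv1a : (d * e₁ - d * e₂) * (d * e₁ - d * e₃) ≠ 0 := by rw [hT1a]; exact mul_ne_zero (pow_ne_zero 2 hd0) (mul_ne_zero he12 he13)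
  have hv1b : d * e₁ - d * e₂ ≠ 0 := by rw [hT1b]; exact mul_ne_zero hd0 he12
  have hv2a : d * e₂ - d * e₁ ≠ 0 := by rw [hT2a]; exact mul_ne_zero hd0 he21
  have hv2b : (d * e₂ - d * e₁) * (d * e₂ - d * e₃) ≠ 0 := by rw [hT2b]; exact mul_ne_zero (pow_ne_zero 2 hd0) (mul_ne_zero he21 he23)
  refine (E.quadraticTwist d).natCard_selmerGroup_eq_four_mul h' q
    (twoDescentClass_mem_selmerGroup_T₁ _ h' (Units.mk0 _ hv1a) (Units.mk0 _ hv1b) rfl rfl)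
    (twoDescentClass_mem_selmerGroup_T₂ _ h' (Units.mk0 _ hv2a) (Units.mk0 _ hv2b) rfl rfl)
    (Units.mk0 _ hv1a) (Units.mk0 _ hv1b) (Units.mk0 _ hv2a) (Units.mk0 _ hv2b)
    ((E.quadraticTwist d).kummerEquiv_twoTorsionCharH1_twoDescentClass h' _ _)
    ((E.quadraticTwist d).kummerEquiv_twoTorsionCharH1_swap_twoDescentClass h' _ _)
    ((E.quadraticTwist d).kummerEquiv_twoTorsionCharH1_twoDescentClass h' _ _)
    ((E.quadraticTwist d).kummerEquiv_twoTorsionCharH1_swap_twoDescentClass h' _ _) ⟨?_, ?_⟩ ⟨?_, ?_⟩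
  · rw [Units.val_mk0, hT1a]; exact hp2 (mul_ne_zero he12 he13) (by rw [padicValRat.mul he12 he13, h12, h13, add_zero])
  · rw [Units.val_mk0, hT1b]; exact hp1 he12 h12
  · rw [Units.val_mk0, hT2a]; exact hp1 he21 h21
  · rw [Units.val_mk0, hT2b]; exact hp2 (mul_ne_zero he21 he23) (by rw [padicValRat.mul he21 he23, h21, h23, add_zero])

end Parity

end Summit.BirchSwinnertonDyer.BirchSwinnertonDyer.Theorems.GenusKolyvaginAtTwo.TorsionCellD0

end
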